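import Mathlib
import Summits.ResolutionOfSingularities.ResolutionOfSingularities.Theses.PAlteration
import Summits.ResolutionOfSingularities.ResolutionOfSingularities.Theorems.PAlterationAssembly2FunctionField
import Literature.AlgebraicGeometry.Resolution.NormalSectionsIntegrallyClosed
import Literature.AlgebraicGeometry.Resolution.SurfaceResolutionReduction

/-!
# ResolutionOfSingularities / pAlteration — `Assembly2` (item `stmt-ResolutionOfSingularities-10476`)

`PalterationThesis → PicoverToRadicialBottom → DescentReducedToIntegral → ResolutionOfSingularities`,
true for EVERY ground field `k` (Temkin 2013, Rem. 1.3.5(i); Stacks 035Q, 0BXR, 03H0, 04DF, 01S4).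
Fix a prime `p`; `RadicialBottom_p := hRB p hp (hT p hp).2`. For `X` reduced separated of finite
type over `k`: `DescentReducedToIntegral` reduces to `X` integral, `HasResolution.of_normalization`
(in tree) to `X` NORMAL; `PIAlt_p = (hT p hp).1` gives `g : X₁ → X` proper surjective, `X₁`
integral regular, `g` finite and universally injective over a dense open `U`. With
`X'' := g.normalization` (Mathlib's relative normalization of `X` in `X₁`), `g = g' ≫ h`:

* `isBirational_toNormalization`: `g'` is birational (Zariski's Main Theorem, Mathlib
  `Scheme.Hom.exists_isIso_morphismRestrict_toNormalization`) and proper, so `X₁` resolves `X''`;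
* `K(X₁)/K(X)` is finite and purely inseparable (`PAlterationAssembly2FunctionField`: `g` is finite
  and radicial over an affine `V ⊆ U` containing the generic point);
* `isFinite_fromNormalization_of_finiteDimensional`: `h` is FINITE (E. Noether,
  `NoetherFiniteIntegralClosure_holds`: the integral closure of `Γ(X, V)` in `Γ(X₁, g⁻¹V) ⊆ K(X₁)`
  is a submodule of the finite `integralClosure Γ(X, V) K(X₁)` over the Noetherian `Γ(X, V)`);
* `universallyInjective_fromNormalization`: `h` is RADICIAL as `X` is normal (an element `c` of
  `Γ(X₁, g⁻¹V)` integral over `A = Γ(X, V)` has `c^{p^n} ∈ K(X)` integral over `A`, so in `A`; a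
  ring map with this property is injective on geometric points); `h` is surjective as `g` is;
* `RadicialBottom_p` transfers the resolution of `X''` along `h` to `X`.
-/

noncomputable section

open CategoryTheory AlgebraicGeometry TopologicalSpace Opposite

namespace Summit.ResolutionOfSingularities.ResolutionOfSingularities.Theorems

set_option linter.dupNamespace false -- mandated namespace of this single-conjunct summit

universe u

open Literature.AlgebraicGeometry.Resolution Literature.AlgebraicGeometry.Motives
  Literature.AlgebraicGeometry.Motives.RatFn

/-! ## Pure algebra: radicial ring maps -/

section Algebra

/-- If `A` is integrally closed in the field `F`, `E/F` is purely inseparable of exponential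
characteristic `p`, and `B` is an `A`-algebra embedded in `E` over `A`, then every element of
`B` integral over `A` has a `p^n`-th power coming from `A`. [folklore] -/
theorem exists_algebraMap_eq_pow_of_isPurelyInseparable {A B F E : Type*} [CommRing A]
    [CommRing B] [Field F] [Field E] [Algebra A B] [Algebra A F] [Algebra F E] [Algebra A E]
    [IsScalarTower A F E] [Algebra B E] [IsScalarTower A B E]
    (hA : ∀ z : F, IsIntegral A z → z ∈ (algebraMap A F).range)
    (hBE : Function.Injective (algebraMap B E)) (p : ℕ) [ExpChar F p] [IsPurelyInseparable F E]
    {b : B} (hb : IsIntegral A b) : ∃ (n : ℕ) (a : A), algebraMap A B a = b ^ p ^ n := by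
  obtain ⟨n, y, hy⟩ := IsPurelyInseparable.pow_mem F p (algebraMap B E b)
  have hyint : IsIntegral A y := by
    have h1 : IsIntegral A ((algebraMap B E b) ^ p ^ n) := hb.algebraMap.pow _
    rw [← hy] at h1
    exact (isIntegral_algHom_iff (IsScalarTower.toAlgHom A F E) (algebraMap F E).injective).mp h1
  obtain ⟨a, ha⟩ := hA y hyint
  refine ⟨n, a, hBE ?_⟩
  rw [← IsScalarTower.algebraMap_apply A B E a, map_pow, IsScalarTower.algebraMap_apply A F E a,
    ha, hy]

/-- A ring map `φ : A → C` in characteristic `p` such that every element of `C` has a `p^n`-th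
power in the image of `A` induces a universally injective (radicial) `Spec C → Spec A`: two
geometric points `C → K` with the same restriction to `A` agree after the injective
`p^n`-th power map of the field `K` (Stacks 01S4). [folklore] -/
theorem universallyInjective_specMap_of_pow_mem {A C : Type u} [CommRing A] [CommRing C]
    (φ : A →+* C) (p : ℕ) [Fact p.Prime] [CharP A p]
    (h : ∀ c : C, ∃ (n : ℕ) (a : A), φ a = c ^ p ^ n) :
    UniversallyInjective (Spec.map (CommRingCat.ofHom φ)) := by
  refine ((tfae_universallyInjective (Spec.map (CommRingCat.ofHom φ))).out 0 1).mpr ?_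
  intro K _ s₁ s₂ hs
  obtain ⟨ψ₁, rfl⟩ := Spec.map_surjective s₁
  obtain ⟨ψ₂, rfl⟩ := Spec.map_surjective s₂
  dsimp only at hs
  rw [← Spec.map_comp, ← Spec.map_comp] at hs
  have hs' := congrArg CommRingCat.Hom.hom (Spec.map_injective hs)
  simp only [CommRingCat.hom_comp, CommRingCat.hom_ofHom] at hs'
  -- `K` has characteristic `p`
  have hpK : (p : K) = 0 := by
    rw [← map_natCast (ψ₁.hom.comp φ) p, CharP.cast_eq_zero, map_zero]
  haveI : CharP K p := (CharP.charP_iff_prime_eq_zero Fact.out).mpr hpK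
  haveI : ExpChar K p := ExpChar.prime Fact.out
  congr 1
  ext c
  obtain ⟨n, a, ha⟩ := h c
  apply iterateFrobenius_inj K p n
  rw [iterateFrobenius_def, iterateFrobenius_def, ← map_pow, ← map_pow, ← ha]
  exact DFunLike.congr_fun hs' a

end Algebra

/-! ## The relative normalization of a dominant morphism of integral schemes -/

section Normalization

variable {X Y : Scheme.{u}} [IsIntegral X] [IsIntegral Y] (f : X ⟶ Y) [IsDominant f]
  [QuasiCompact f] [QuasiSeparated f]

/-- The generic point lies in every non-empty open. [folklore] -/
theorem genericPoint_mem_of_nonempty (U : Y.Opens) [hU : Nonempty U] : genericPoint Y ∈ U :=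
  ((genericPoint_spec Y).mem_open_set_iff U.isOpen).mpr
    (by obtain ⟨y⟩ := hU; simpa using ⟨y.1, y.2⟩)

omit [QuasiCompact f] [QuasiSeparated f] in
/-- Affine piece of the finiteness of the normalization: over a non-empty affine open `U` of a
variety `Y/k`, the integral closure of `Γ(Y, U)` in `Γ(X, f⁻¹U)` is a finite `Γ(Y, U)`-module
when `K(X)/K(Y)` is finite — it embeds into the integral closure of `Γ(Y, U)` in `K(X)`, finite
by E. Noether (`NoetherFiniteIntegralClosure_holds`), and `Γ(Y, U)` is Noetherian. [folklore] -/
theorem finite_integralClosure_sections_of_finiteDimensional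
    [FiniteDimensional Y.functionField (FunctionFieldOver f)]
    {k : Type u} [Field k] (q : Y ⟶ Spec (.of k)) [LocallyOfFiniteType q]
    (U : Y.affineOpens) [hU : Nonempty (U : Y.Opens)] :
    letI := (f.app U).hom.toAlgebra
    Module.Finite Γ(Y, U) (integralClosure Γ(Y, U) Γ(X, f ⁻¹ᵁ U)) := by
  letI algAB := (f.app U).hom.toAlgebra
  have hξU : genericPoint Y ∈ (U : Y.Opens) := genericPoint_mem_of_nonempty (U : Y.Opens)
  -- `Γ(Y, U)` is a finitely generated `k`-algebra, a domain with fraction field `K(Y)`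
  let φ : k →+* Γ(Y, U) :=
    (q.appLE ⊤ U le_top).hom.comp (Scheme.ΓSpecIso (.of k)).inv.hom
  have hφ : φ.FiniteType := by
    refine RingHom.FiniteType.comp ?_ (RingHom.FiniteType.of_surjective _
      (Scheme.ΓSpecIso (.of k)).symm.commRingCatIsoToRingEquiv.surjective)
    exact HasRingHomProperty.appLE @LocallyOfFiniteType q ‹_› ⟨⊤, isAffineOpen_top _⟩ U le_top
  letI : Algebra k Γ(Y, U) := φ.toAlgebra
  haveI : Algebra.FiniteType k Γ(Y, U) := hφ
  haveI : IsFractionRing Γ(Y, U) Y.functionField :=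
    functionField_isFractionRing_of_isAffineOpen Y U U.2
  haveI : IsNoetherianRing Γ(Y, U) := Algebra.FiniteType.isNoetherianRing k Γ(Y, U)
  -- `L = K(X)` as a `Γ(Y, U)`-algebra through `K(Y)`
  let L := FunctionFieldOver f
  letI algL : Algebra Γ(Y, U) L :=
    ((algebraMap Y.functionField L).comp (algebraMap Γ(Y, U) Y.functionField)).toAlgebra
  haveI : IsScalarTower Γ(Y, U) Y.functionField L :=
    IsScalarTower.of_algebraMap_eq (R := Γ(Y, U)) (S := Y.functionField) (A := L) fun a => rfl
  haveI hfin : Module.Finite Γ(Y, U) (integralClosure Γ(Y, U) L) :=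
    NoetherFiniteIntegralClosure_holds k Γ(Y, U) Y.functionField L
  -- the injective `Γ(Y, U)`-algebra map `Γ(X, f⁻¹U) → L`
  let ι : Γ(X, f ⁻¹ᵁ U) →ₐ[Γ(Y, U)] L :=
    { toRingHom := FunctionFieldOver.ofPreimageSection f hξU
      commutes' := fun a => by
        rw [RingHom.algebraMap_toAlgebra]
        exact FunctionFieldOver.ofPreimageSection_app f hξU a }
  have hι : Function.Injective ι :=
    (FunctionFieldOver.of f).injective.comp (germ_injective_of_isIntegral _ _ _)
  let ι' : integralClosure Γ(Y, U) Γ(X, f ⁻¹ᵁ U) →ₐ[Γ(Y, U)] integralClosure Γ(Y, U) L :=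
    (ι.comp (integralClosure Γ(Y, U) Γ(X, f ⁻¹ᵁ U)).val).codRestrict
      (integralClosure Γ(Y, U) L) fun x => ((mem_integralClosure_iff _ _).mp x.2).map ι
  have hι' : Function.Injective ι' := fun x y hxy =>
    Subtype.ext (hι (congrArg Subtype.val hxy))
  exact Module.Finite.of_injective ι'.toLinearMap hι'

/-- **The normalization of `Y` in `X` is finite over `Y`** for a dominant qcqs morphism
`f : X → Y` of integral schemes with `K(X)/K(Y)` finite and `Y` locally of finite type over a
field (E. Noether; Liu 2002, Prop. 4.1.27). [folklore] -/
theorem isFinite_fromNormalization_of_finiteDimensional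
    [FiniteDimensional Y.functionField (FunctionFieldOver f)]
    {k : Type u} [Field k] (q : Y ⟶ Spec (.of k)) [LocallyOfFiniteType q] :
    IsFinite f.fromNormalization :=
  isFinite_fromNormalization_of_finite f
    (fun U : {U : Y.affineOpens // Nonempty (U : Y.Opens)} => U.1)
    (iSup_nonempty_affineOpens_eq_top Y)
    fun U => haveI := U.2; finite_integralClosure_sections_of_finiteDimensional f q U.1

/-- Affine piece of `universallyInjective_fromNormalization`: over a non-empty affine open `U`
of the normal `Y`, `f.normalization ×_Y U = Spec C → U = Spec A` with `C` the integral closure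
of `A = Γ(Y, U)` in `Γ(X, f⁻¹U)`, and `A → C` is radicial. [folklore] -/
theorem universallyInjective_fromNormalization_restrict
    (hN : ∀ y : Y, IsIntegrallyClosed (Y.presheaf.stalk y)) (p : ℕ) [Fact p.Prime]
    [CharP Y.functionField p] [IsPurelyInseparable Y.functionField (FunctionFieldOver f)]
    (U : Y.affineOpens) [Nonempty (U : Y.Opens)] :
    UniversallyInjective (f.fromNormalization ∣_ (U : Y.Opens)) := by
  have hξU : genericPoint Y ∈ (U : Y.Opens) := genericPoint_mem_of_nonempty (U : Y.Opens)
  let e := IsOpenImmersion.isoOfRangeEq (f.fromNormalization ⁻¹ᵁ U).ι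
    (f.normalizationOpenCover.f U)
    (by simpa using congr($(f.fromNormalization_preimage U).1))
  rw [← MorphismProperty.cancel_left_of_respectsIso @UniversallyInjective e.inv,
    ← MorphismProperty.cancel_right_of_respectsIso @UniversallyInjective _ U.2.isoSpec.hom]
  have heq : (e.inv ≫ f.fromNormalization ∣_ (U : Y.Opens)) ≫ U.2.isoSpec.hom =
      Spec.map (f.normalizationDiagramMap.app (.op U.1)) := by
    rw [← cancel_mono U.2.fromSpec]
    simp [IsAffineOpen.isoSpec_hom, e, Scheme.Hom.ι_fromNormalization]
    rfl
  rw [heq]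
  -- the affine piece `Spec (integral closure of Γ(Y, U) in Γ(X, f⁻¹U)) → Spec Γ(Y, U)`
  letI algAB := (f.app U).hom.toAlgebra
  change UniversallyInjective (Spec.map (CommRingCat.ofHom
    (algebraMap Γ(Y, U) (integralClosure Γ(Y, U) Γ(X, f ⁻¹ᵁ U)))))
  -- the algebras `Γ(Y, U) → K(Y) → L = K(X)` and `Γ(Y, U) → Γ(X, f⁻¹U) → L`
  let L := FunctionFieldOver f
  letI algBL : Algebra Γ(X, f ⁻¹ᵁ U) L := (FunctionFieldOver.ofPreimageSection f hξU).toAlgebra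
  letI algAL : Algebra Γ(Y, U) L :=
    ((algebraMap Y.functionField L).comp (algebraMap Γ(Y, U) Y.functionField)).toAlgebra
  haveI : IsScalarTower Γ(Y, U) Y.functionField L :=
    IsScalarTower.of_algebraMap_eq (R := Γ(Y, U)) (S := Y.functionField) (A := L) fun a => rfl
  haveI : IsScalarTower Γ(Y, U) Γ(X, f ⁻¹ᵁ U) L :=
    IsScalarTower.of_algebraMap_eq (R := Γ(Y, U)) (S := Γ(X, f ⁻¹ᵁ U)) (A := L) fun a =>
      (FunctionFieldOver.ofPreimageSection_app f hξU a).symm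
  have hBE : Function.Injective (algebraMap Γ(X, f ⁻¹ᵁ U) L) :=
    (FunctionFieldOver.of f).injective.comp (germ_injective_of_isIntegral _ _ _)
  have hA : ∀ z : Y.functionField, IsIntegral Γ(Y, U) z →
      z ∈ (algebraMap Γ(Y, U) Y.functionField).range :=
    fun z hz => mem_range_of_isIntegral_sections hN U z hz
  haveI : CharP Γ(Y, U) p :=
    RingHom.charP _ (Y.germToFunctionField_injective U) p
  haveI : ExpChar Y.functionField p := ExpChar.prime Fact.out
  apply universallyInjective_specMap_of_pow_mem _ p
  rintro ⟨c, hc⟩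
  obtain ⟨n, a, ha⟩ := exists_algebraMap_eq_pow_of_isPurelyInseparable
    (A := Γ(Y, U)) (B := Γ(X, f ⁻¹ᵁ U)) (F := Y.functionField) (E := L) hA hBE p
    ((mem_integralClosure_iff _ _).mp hc)
  refine ⟨n, a, Subtype.ext ?_⟩
  simpa using ha

/-- **The normalization of a normal `Y` in a purely inseparable extension is radicial over
`Y`**: for a dominant qcqs morphism `f : X → Y` of integral schemes with `Y` normal (all local
rings integrally closed), `K(Y)` of characteristic `p` and `K(X)/K(Y)` purely inseparable,
`f.normalization → Y` is universally injective. [folklore] -/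
theorem universallyInjective_fromNormalization
    (hN : ∀ y : Y, IsIntegrallyClosed (Y.presheaf.stalk y)) (p : ℕ) [Fact p.Prime]
    [CharP Y.functionField p] [IsPurelyInseparable Y.functionField (FunctionFieldOver f)] :
    UniversallyInjective f.fromNormalization := by
  rw [IsZariskiLocalAtTarget.iff_of_iSup_eq_top (P := @UniversallyInjective) _
    (iSup_nonempty_affineOpens_eq_top Y)]
  intro U
  haveI := U.2
  exact universallyInjective_fromNormalization_restrict f hN p U.1

end Normalization

/-! ## Zariski's Main Theorem: `X → f.normalization` is birational -/

section Birational

variable {X Y : Scheme.{u}} [IsIntegral X] (f : X ⟶ Y)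

/-- **`X → f.normalization` is birational** for a separated morphism of finite type `f : X → Y`
from an integral scheme which is quasi-finite over an open `U ⊆ Y` with `f⁻¹U ≠ ∅`: by
Zariski's Main Theorem (Mathlib `Scheme.Hom.exists_isIso_morphismRestrict_toNormalization`)
`X → f.normalization` is an isomorphism over an open `W` whose preimage is the quasi-finite
locus `⊇ f⁻¹U ≠ ∅` of `f`; `W` and its preimage are non-empty opens of integral schemes, hence
dense. [folklore] -/
theorem isBirational_toNormalization [LocallyOfFiniteType f] [IsSeparated f] [QuasiCompact f]
    (U : Y.Opens) (hne : ((f ⁻¹ᵁ U : X.Opens) : Set X).Nonempty) [LocallyQuasiFinite (f ∣_ U)] :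
    IsBirational f.toNormalization := by
  obtain ⟨W, hW, hW'⟩ := f.exists_isIso_morphismRestrict_toNormalization
  have hsub : ((f ⁻¹ᵁ U : X.Opens) : Set X) ⊆ (f.toNormalization ⁻¹ᵁ W : Set X) := by
    intro x hx
    have h1 : (f ∣_ U).QuasiFiniteAt ⟨x, hx⟩ := (f ∣_ U).quasiFiniteAt _
    have h2 : ((f ∣_ U) ≫ U.ι).QuasiFiniteAt ⟨x, hx⟩ :=
      Scheme.Hom.quasiFiniteAt_comp_iff.mpr h1
    have h2' : ((f ⁻¹ᵁ U).ι ≫ f).QuasiFiniteAt ⟨x, hx⟩ := by rwa [← morphismRestrict_ι]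
    have h3 : f.QuasiFiniteAt x := by
      simpa using (Scheme.Hom.quasiFiniteAt_comp_iff_of_isOpenImmersion.mp h2')
    change x ∈ (f.toNormalization ⁻¹ᵁ W).1
    rw [hW']
    exact h3
  have hpre : Dense ((f.toNormalization ⁻¹ᵁ W : X.Opens) : Set X) :=
    (f.toNormalization ⁻¹ᵁ W).2.dense (hne.mono hsub)
  obtain ⟨x, hx⟩ := hne
  have hWd : Dense (W : Set f.normalization) := W.2.dense ⟨f.toNormalization x, hsub hx⟩
  exact ⟨W, hWd, hpre, hW⟩

omit [IsIntegral X] in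
/-- `X → f.normalization` is proper when `f` is (`f.normalization → Y` is affine, hence
separated). [folklore] -/
theorem isProper_toNormalization [IsProper f] : IsProper f.toNormalization := by
  have : IsProper (f.toNormalization ≫ f.fromNormalization) := by
    rw [f.toNormalization_fromNormalization]; infer_instance
  exact IsProper.of_comp f.toNormalization f.fromNormalization

/-- **A regular proper `X`, quasi-finite over a non-empty open of `Y`, resolves the
normalization of `Y` in `X`.** [folklore] -/
theorem hasResolution_normalization_of_isRegular [IsProper f] (hreg : Scheme.IsRegular X)
    (U : Y.Opens) (hne : ((f ⁻¹ᵁ U : X.Opens) : Set X).Nonempty) [LocallyQuasiFinite (f ∣_ U)] :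
    Scheme.HasResolution f.normalization :=
  haveI := isProper_toNormalization f
  ⟨X, f.toNormalization, ⟨inferInstance, isBirational_toNormalization f U hne, hreg⟩⟩

end Birational

/-! ## The assembly -/

section Assembly

/-- **Main lemma**: over a field of characteristic `p`, a NORMAL integral separated scheme of
finite type has a resolution, given `PIAlt_p` (purely inseparable regular alterations exist)
and `RadicialBottom_p` (resolutions descend along finite radicial surjections): normalise `X`
in the alteration `X₁ → X` and apply `RadicialBottom_p` to `X₁^{ν} → X`. [folklore] -/
theorem hasResolution_of_normal_of_pialt_of_radicialBottom {p : ℕ} (hp : p.Prime)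
    (hPI : ∀ (k : Type) [Field k] [CharP k p] (X : Scheme.{0}) (f : X ⟶ Spec (.of k)),
      IsSeparated f → LocallyOfFiniteType f → QuasiCompact f → IsIntegral X →
      ∃ (X' : Scheme.{0}) (g : X' ⟶ X), IsProper g ∧ IsIntegral X' ∧ Scheme.IsRegular X' ∧
        Function.Surjective g.base ∧ ∃ U : X.Opens, Dense (U : Set X) ∧
        IsFinite (g ∣_ U) ∧ UniversallyInjective (g ∣_ U))
    (hRB : ∀ (k : Type) [Field k] [CharP k p] (X X'' : Scheme.{0}) (f : X ⟶ Spec (.of k))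
      (g : X'' ⟶ X), IsSeparated f → LocallyOfFiniteType f → QuasiCompact f → IsIntegral X →
      IsIntegral X'' → IsFinite g → UniversallyInjective g → Function.Surjective g.base →
      Scheme.HasResolution X'' → Scheme.HasResolution X)
    (k : Type) [Field k] [CharP k p] (X : Scheme.{0}) (f : X ⟶ Spec (.of k)) [IsSeparated f]
    [LocallyOfFiniteType f] [QuasiCompact f] [IsIntegral X]
    (hN : ∀ x : X, IsIntegrallyClosed (X.presheaf.stalk x)) : Scheme.HasResolution X := by
  haveI : Fact p.Prime := ⟨hp⟩
  obtain ⟨X₁, g, hgprop, hint₁, hreg₁, hsurj, U, hUd, hfinU, huiU⟩ :=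
    hPI k X f ‹_› ‹_› ‹_› ‹_›
  haveI := hgprop
  haveI := hint₁
  haveI : IsDominant g := ⟨hsurj.denseRange⟩
  -- an affine open `V ⊆ U` of `X` containing the generic point
  have hξU : genericPoint X ∈ U :=
    ((genericPoint_spec X).mem_open_set_iff U.isOpen).mpr (by simpa using hUd.nonempty)
  obtain ⟨_, ⟨V, hVaff, rfl⟩, hξV, hVU⟩ :=
    X.isBasis_affineOpens.exists_subset_of_mem_open hξU U.isOpen
  haveI : IsFinite (g ∣_ V) := morphismRestrict_of_le g (P := @IsFinite) hVU hfinU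
  haveI : UniversallyInjective (g ∣_ V) :=
    morphismRestrict_of_le g (P := @UniversallyInjective) hVU huiU
  have hVaff' : IsAffineOpen (g ⁻¹ᵁ V) :=
    isAffineOpen_preimage_of_isAffineHom_morphismRestrict g hVaff
  have hfin : (g.app V).hom.Finite :=
    (IsFinite.SpecMap_iff _).mp
      ((morphismRestrict_iff_specMap_app g hVaff hVaff' (P := @IsFinite)).mp ‹_›)
  haveI : UniversallyInjective (Spec.map (g.app V)) :=
    (morphismRestrict_iff_specMap_app g hVaff hVaff' (P := @UniversallyInjective)).mp ‹_›
  -- the function field extension `K(X₁)/K(X)` is finite and purely inseparable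
  haveI : FiniteDimensional X.functionField (FunctionFieldOver g) :=
    finiteDimensional_functionFieldOver_of_finite g hξV hVaff' hfin
  haveI : IsPurelyInseparable X.functionField (FunctionFieldOver g) :=
    isPurelyInseparable_functionFieldOver_of_universallyInjective g hξV hVaff'
  haveI : CharP X.functionField p := by
    let ι : k →+* X.functionField :=
      (X.presheaf.germ ⊤ (genericPoint X) trivial).hom.comp
        (f.appTop.hom.comp (Scheme.ΓSpecIso (.of k)).inv.hom)
    exact (ι.charP_iff_charP p).mp ‹_›
  -- the normalization `X'' := g.normalization` of `X` in `X₁`, `g = g' ≫ h`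
  haveI hfinh : IsFinite g.fromNormalization :=
    isFinite_fromNormalization_of_finiteDimensional g f
  haveI hui : UniversallyInjective g.fromNormalization :=
    universallyInjective_fromNormalization g hN p
  have hsurjh : Function.Surjective g.fromNormalization.base := by
    intro x
    obtain ⟨x₁, hx₁⟩ := hsurj x
    refine ⟨g.toNormalization.base x₁, ?_⟩
    change (g.toNormalization ≫ g.fromNormalization).base x₁ = x
    rw [g.toNormalization_fromNormalization]
    exact hx₁
  have hne : ((g ⁻¹ᵁ V : X₁.Opens) : Set X₁).Nonempty :=
    ⟨genericPoint X₁, genericPoint_mem_preimage g hξV⟩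
  have hres : Scheme.HasResolution g.normalization :=
    hasResolution_normalization_of_isRegular g hreg₁ V hne
  exact hRB k X g.normalization f g.fromNormalization ‹_› ‹_› ‹_› ‹_› inferInstance hfinh hui
    hsurjh hres

/-- **`Assembly2`** (item `stmt-ResolutionOfSingularities-10476`, route `pAlteration`): the
thesis `PIAlt ∧ PICover` (for every prime), the reduction `PICover_p → RadicialBottom_p` and the
reduction reduced → integral together imply resolution of singularities in every positive
characteristic: reduce to `X` integral (`DescentReducedToIntegral`), then normal
(`Scheme.HasResolution.of_normalization`), then apply
`hasResolution_of_normal_of_pialt_of_radicialBottom`. [folklore] -/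
theorem assembly2_proof :
    Summit.ResolutionOfSingularities.ResolutionOfSingularities.Theses.PAlteration.Assembly2 := by
  unfold Theses.PAlteration.Assembly2
  intro hT hRB hD p hp k _ _ X f hsep hlft hqc hred
  refine hD k ?_ X f hsep hlft hqc hred
  intro X f hsep hlft hqc hint
  haveI := hsep; haveI := hlft; haveI := hqc; haveI := hint
  haveI : IsFinite (normalizationι X) :=
    isFinite_normalizationι X NoetherFiniteIntegralClosure_holds f
  refine Scheme.HasResolution.of_normalization X f ?_
  exact hasResolution_of_normal_of_pialt_of_radicialBottom hp (hT p hp).1 (hRB p hp (hT p hp).2)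
    k (normalization X) (normalizationι X ≫ f) (isIntegrallyClosed_stalk_normalization X)

end Assembly

end Summit.ResolutionOfSingularities.ResolutionOfSingularities.Theorems

end
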